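import Summits.BirchSwinnertonDyer.BirchSwinnertonDyer.Theorems.BiquadraticEisensteinDescentHeegnerTwistCouplingInSupplySymbolicMonskyRealise
import Summits.BirchSwinnertonDyer.BirchSwinnertonDyer.Theorems.BiquadraticEisensteinDescentHeegnerTwistCouplingInSupplyCornersE2pOneFact
import Summits.BirchSwinnertonDyer.BirchSwinnertonDyer.Theorems.BiquadraticEisensteinDescentHeegnerTwistCouplingInSupplySizeIndivisibleSharp
import Literature.NumberTheory.EllipticCurves.Kriz2020.GoldfeldJ1728Proofs
import HarnessLib

set_option linter.dupNamespace false -- `Summit.BirchSwinnertonDyer.BirchSwinnertonDyer.Theorems.…` (summit = sub)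
set_option autoImplicit false

/-!
# Crux `HeegnerTwistCouplingInSupply` (stmt-BirchSwinnertonDyer-21381), crux idea `sign-table-character-dichotomy`:
# THE DOOR — a winning recipe of the sign-table game REALISED by small primes gives the crux's conclusion for the
# two-parameter congruent families `W = E_{pr}`, `W = E_{2pr}`, modulo Burungale–Tian ONLY

Cell `pub/bsd-wall`, width-prover seat `bsd-wall-cm-bed-w3` g18 (explicit-unit; helper for stmt-BirchSwinnertonDyer-21381, closes nothing).
Fifth file of the symbolic Monsky engine (`…SymbolicMonskyDefs/Sound/Transport/Realise`, covers `…SignTableCoversDefs`, completion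
lemmas `…SignTableCompletion(.Even)`). The card's transfer statement `C⁺_game` (Sketch `GameClosureK1Odd`) asks, for `p ≥ p₀(r)`, for
auxiliary primes `q₁ … q_t` with `d = −q₁⋯q_t ≡ 1 (8)`, `(d/p) = (d/r) = +1`, `√|d| log|d| < πp` and `det M_odd(p, r, q…) = 1`; here we
prove what such primes BUY, in the crux's own currency:

* `Recipe.RealisesK1.exists_heegnerField` — `K′ = ℚ(√−q₁⋯q_t)` (tree `sqrtField`): imaginary quadratic, `d_{K′} = −q₁⋯q_t`,
  `|d_{K′}| > 4`, Heegner for every level supported on the primes of `2pr` (tree `satisfiesHeegnerHypothesis_sqrtField_of_squarefree_natAbs`;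
  the splitting of `2, p, r` is the recipe's Heegner check, `…Realise.lean`), and `p ∤ h(K′)` from `√|d| log|d| < πp` (Oesterlé; tree
  `not_dvd_classNumber_of_sqrt_mul_log_lt_pi_mul`).
* `Recipe.RealisesK1.L_ne_zero_odd/even` — `L(E_{pr}^{(d)}, 1) ≠ 0` / `L(E_{2pr}^{(d)}, 1) ≠ 0` modulo Burungale–Tian ONLY:
  `E_n^{(d)} = E_{n|d|}` (tree `quadraticTwist_congruentNumberCurve`), `det M = 1` for the actual primes (this engine), `#Sel₂ = 4` by
  Monsky's theorem (a tree THEOREM, `card_selmerGroup_two_eq_four_of_det_odd'/even'`) and the rank-zero `2`-converse for CM curves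
  (named fact `burungaleTian_analyticRank_eq_zero_of_selmerCorank_eq_zero_of_hasCM`, via the tree's
  `L_one_ne_zero_congruentNumberCurve_of_card_selmerGroup_two`).
* `Recipe.RealisesK1.cruxOnEpr_of_BT` / `cruxOnE2pr_of_BT` — THE DOOR: ∃ `K′` imaginary quadratic, `4 < |d_{K′}|`, Heegner for
  `N(W)` (support `⊆ {2, p, r}`, modularity-free: tree `dvd_two_mul_of_prime_dvd_conductorNorm`), `L(W^{(d_{K′})}, 1) ≠ 0`, `p ∤ h(K′)`.
* ★ `heegnerTwistCouplingInSupply_of_signTable_of_BT` / `…_even_of_BT` — the crux BODY (binders of `HeegnerTwistCouplingInSupply`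
  verbatim) on `W = E_{pr}` / `E_{2pr}` under the ONE extra hypothesis «some winning recipe is realised by primes `q` with
  `√(∏q) log(∏q) < πp`», modulo Burungale–Tian ONLY.

HONEST LIMITS: the realisation hypothesis is exactly the card's untyped analytic input (Dirichlet cells + Burgess/Vinogradov exclusion of
character columns + bilinear sieve for the mutual symbols, with the size bound); by `…SignTableCompletion.lean` a winning recipe EXISTS
against every non-character column, but its realisation by small primes is NOT proved here. Congruent-number (`j = 1728`, full
`2`-torsion) families only; the crux as stated (C⁺) and BSD are NOT touched; nothing is closed. THEOREMS ONLY. Supports stmt-BirchSwinnertonDyer-21381.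
-/

namespace Summit.BirchSwinnertonDyer.BirchSwinnertonDyer.Theorems.SymbolicMonsky

open Matrix Literature.NumberTheory.EllipticCurves Literature.NumberTheory.EllipticCurves.HeathBrown1994
  Literature.NumberTheory.EllipticCurves.HeathBrown1994.Families

section Door

open Literature.NumberTheory.EllipticCurves.Rank1Residual
open Literature.NumberTheory.EllipticCurves.CongruentNumberMonskySelmer
  (card_selmerGroup_two_eq_four_of_det_even' card_selmerGroup_two_eq_four_of_det_odd')
open Summit.BirchSwinnertonDyer.BirchSwinnertonDyer.Theorems.BiquadraticEisensteinDescentHeegnerTwistCouplingInSupplyCornersThreeFacts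
  (dvd_two_mul_of_prime_dvd_conductorNorm)
open Summit.BirchSwinnertonDyer.BirchSwinnertonDyer.Theorems.BiquadraticEisensteinDescentHeegnerTwistCouplingInSupplySizeIndivisibleSharp
  (not_dvd_classNumber_of_sqrt_mul_log_lt_pi_mul)

variable {rcp : Recipe} {pc rc : Fin 4} {rp : Bool} {p r : ℕ} {q : Fin rcp.t → ℕ}

namespace Recipe.RealisesK1

/-- `∏ (p, r, q…) = p · (r · ∏ q)`. -/
theorem prod_cons : ∏ i, (Fin.cons p (Fin.cons r q) : Fin (rcp.t + 2) → ℕ) i = p * (r * ∏ i, q i) := by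
  rw [Fin.prod_univ_succ, Fin.prod_univ_succ]
  simp

/-- All the primes `(p, r, q…)` are odd. -/
theorem odd_cons (h : rcp.RealisesK1 pc rc rp p r q) : ∀ i, Odd ((Fin.cons p (Fin.cons r q) : Fin (rcp.t + 2) → ℕ) i) :=
  fun i => Nat.odd_iff.mpr (h.toMatches.mod_two i)

/-- `p · r · q₁⋯q_t` is squarefree. -/
theorem squarefree_prod (h : rcp.RealisesK1 pc rc rp p r q) : Squarefree (p * (r * ∏ i, q i)) := by
  rw [← prod_cons]
  exact squarefree_prod_of_injective _ h.toMatches.prime h.toMatches.injective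

/-- `q₁⋯q_t` is squarefree. -/
theorem squarefree_prod_q (h : rcp.RealisesK1 pc rc rp p r q) : Squarefree (∏ i, q i) :=
  squarefree_prod_of_injective _ h.qprime h.qinj

/-- **The Heegner field** `K′ = ℚ(√−q₁⋯q_t)` of a realised recipe passing the Heegner check: imaginary quadratic,
`d_{K′} = −q₁⋯q_t`, `|d_{K′}| > 4`, Heegner for every level supported on the primes of `2pr`, and — given the size bound
`√(q₁⋯q_t)·log(q₁⋯q_t) < π p` (Oesterlé) — `p ∤ h(K′)`. [cite: Oesterle1988Gauss, II §3 Proposition p. 57 (27)] -/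
theorem exists_heegnerField (h : rcp.RealisesK1 pc rc rp p r q) (hh : rcp.heegner pc (some rc) = true)
    {N : ℕ} (hN : ∀ ℓ : ℕ, ℓ.Prime → ℓ ∣ N → ℓ ∣ 2 * (p * r))
    (hsize : Real.sqrt ((∏ i, q i : ℕ) : ℝ) * Real.log ((∏ i, q i : ℕ) : ℝ) < Real.pi * p) :
    ∃ (K : Type) (_ : Field K) (_ : NumberField K),
      IsImaginaryQuadratic K ∧ NumberField.discr K = -((∏ i, q i : ℕ) : ℤ) ∧ 4 < (NumberField.discr K).natAbs ∧
      SatisfiesHeegnerHypothesis N K ∧ ¬ p ∣ NumberField.classNumber K := by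
  have h8 := h.prod_mod_eight hh
  have hJp := h.jacobiSym_neg_prod_p hh
  have hJr := h.jacobiSym_neg_prod_r hh
  set D : ℕ := ∏ i, q i with hD
  have hD7 : 7 ≤ D := by omega
  haveI : Fact ((-(D : ℤ)) < 0) := ⟨by omega⟩
  have hsf : Squarefree (-(D : ℤ)).natAbs := by
    rw [Int.natAbs_neg, Int.natAbs_natCast]; exact h.squarefree_prod_q
  obtain ⟨hK, hdK⟩ := isImaginaryQuadratic_and_discr_sqrtField_of_squarefree_natAbs (-(D : ℤ)) (by omega) hsf
  refine ⟨sqrtField (-(D : ℤ)), inferInstance, inferInstance, hK, hdK, ?_, ?_, ?_⟩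
  · rw [hdK, Int.natAbs_neg, Int.natAbs_natCast]; omega
  · refine satisfiesHeegnerHypothesis_sqrtField_of_squarefree_natAbs _ (by omega) hsf fun ℓ hℓ hℓN => ?_
    rcases (Nat.Prime.dvd_mul hℓ).mp (hN ℓ hℓ hℓN) with h2 | hpr
    · exact Or.inl ((Nat.prime_dvd_prime_iff_eq hℓ Nat.prime_two).mp h2)
    · rcases (Nat.Prime.dvd_mul hℓ).mp hpr with hp' | hr'
      · rw [(Nat.prime_dvd_prime_iff_eq hℓ h.pprime).mp hp']; exact Or.inr hJp
      · rw [(Nat.prime_dvd_prime_iff_eq hℓ h.rprime).mp hr']; exact Or.inr hJr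
  · refine not_dvd_classNumber_of_sqrt_mul_log_lt_pi_mul hK ?_ ?_
    · rw [hdK, Int.natAbs_neg, Int.natAbs_natCast]; omega
    · rw [hdK, Int.natAbs_neg, Int.natAbs_natCast]; exact hsize

/-- **`L(E_{pr}^{(−q₁⋯q_t)}, 1) ≠ 0` modulo Burungale–Tian** for a realised WINNING recipe on the odd base `E_{pr}`:
`E_{pr}^{(d)} = E_{pr|d|}` (tree `quadraticTwist_congruentNumberCurve`), `det M_odd(p, r, q…) = 1` (this engine), `#Sel₂ = 4`
(Monsky, tree theorem) and the rank-zero `2`-converse for CM curves. [cite: BurungaleTian2026, Thm. 1.1]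
[cite: HeathBrown1994SelmerCongruentII, Appendix (Monsky), typescript p. 39 L10–L33] -/
theorem L_ne_zero_odd (hBT : burungaleTian_analyticRank_eq_zero_of_selmerCorank_eq_zero_of_hasCM)
    (h : rcp.RealisesK1 pc rc rp p r q) (hw : rcp.winsPR pc rc rp = true) :
    ((congruentNumberCurve (p * r)).quadraticTwist ((-((∏ i, q i : ℕ) : ℤ) : ℤ) : ℚ)).entireLFunction 1 ≠ 0 := by
  rw [quadraticTwist_congruentNumberCurve, Int.natAbs_neg, Int.natAbs_natCast, mul_assoc]
  have hsq := h.squarefree_prod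
  haveI := isElliptic_congruentNumberCurve hsq.ne_zero
  have hsel : Nat.card ((congruentNumberCurve (p * (r * ∏ i, q i))).selmerGroup 2) = 4 :=
    card_selmerGroup_two_eq_four_of_det_odd' _ prod_cons h.toMatches.prime h.odd_cons h.toMatches.injective (h.det_odd hw)
  exact (L_one_ne_zero_congruentNumberCurve_of_card_selmerGroup_two hBT hsq hsel).2

/-- **`L(E_{2pr}^{(−q₁⋯q_t)}, 1) ≠ 0` modulo Burungale–Tian** for a realised WINNING recipe on the even base `E_{2pr}`.
[cite: BurungaleTian2026, Thm. 1.1] [cite: HeathBrown1994SelmerCongruentII, Appendix (Monsky), typescript p. 41 L20–L36] -/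
theorem L_ne_zero_even (hBT : burungaleTian_analyticRank_eq_zero_of_selmerCorank_eq_zero_of_hasCM)
    (h : rcp.RealisesK1 pc rc rp p r q) (hw : rcp.wins2PR pc rc rp = true) :
    ((congruentNumberCurve (2 * (p * r))).quadraticTwist ((-((∏ i, q i : ℕ) : ℤ) : ℤ) : ℚ)).entireLFunction 1 ≠ 0 := by
  rw [quadraticTwist_congruentNumberCurve, Int.natAbs_neg, Int.natAbs_natCast, mul_assoc, mul_assoc]
  have hsq : Squarefree (2 * (p * (r * ∏ i, q i))) := by
    rw [← prod_cons]
    exact squarefree_two_mul_prod_of_injective _ h.toMatches.prime h.odd_cons h.toMatches.injective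
  haveI := isElliptic_congruentNumberCurve hsq.ne_zero
  have hsel : Nat.card ((congruentNumberCurve (2 * (p * (r * ∏ i, q i)))).selmerGroup 2) = 4 :=
    card_selmerGroup_two_eq_four_of_det_even' _ (by rw [prod_cons]) h.toMatches.prime h.odd_cons h.toMatches.injective
      (h.det_even hw)
  exact (L_one_ne_zero_congruentNumberCurve_of_card_selmerGroup_two hBT hsq hsel).2

/-- **THE DOOR, odd base `W = E_{pr}`: a winning recipe realised by primes with `√(q₁⋯q_t) log(q₁⋯q_t) < π p` gives the
conclusion of `HeegnerTwistCouplingInSupply` for `(E_{pr}, p)` modulo Burungale–Tian ONLY** — `K′ = ℚ(√−q₁⋯q_t)` imaginary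
quadratic with `4 < |d_{K′}|`, Heegner for `N(E_{pr})` (support `⊆ {2, p, r}`, modularity-free), `L(E_{pr}^{(d_{K′})}, 1) ≠ 0` and
`p ∤ h(K′)`. The EXISTENCE of such primes for the actual sign table `q ↦ (q/p)` is the card's analytic input, not supplied here.
[cite: BurungaleTian2026, Thm. 1.1] [cite: Oesterle1988Gauss, II §3 Proposition p. 57 (27)] -/
theorem cruxOnEpr_of_BT (hBT : burungaleTian_analyticRank_eq_zero_of_selmerCorank_eq_zero_of_hasCM)
    (hw : rcp.winsPR pc rc rp = true) (h : rcp.RealisesK1 pc rc rp p r q) [(congruentNumberCurve (p * r)).IsElliptic]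
    (hsize : Real.sqrt ((∏ i, q i : ℕ) : ℝ) * Real.log ((∏ i, q i : ℕ) : ℝ) < Real.pi * p) :
    ∃ (K : Type) (_ : Field K) (_ : NumberField K),
      IsImaginaryQuadratic K ∧ 4 < (NumberField.discr K).natAbs ∧
      SatisfiesHeegnerHypothesis ((congruentNumberCurve (p * r)).conductorNorm ℤ) K ∧
      ((congruentNumberCurve (p * r)).quadraticTwist (NumberField.discr K : ℚ)).entireLFunction 1 ≠ 0 ∧
      ¬ p ∣ NumberField.classNumber K := by
  have hh : rcp.heegner pc (some rc) = true := by
    simp only [Recipe.winsPR, Bool.and_eq_true] at hw; exact hw.1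
  obtain ⟨K, iF, iN, hK, hdK, h4, hH, hcl⟩ := h.exists_heegnerField hh
    (N := (congruentNumberCurve (p * r)).conductorNorm ℤ) (fun ℓ hℓ hℓN => dvd_two_mul_of_prime_dvd_conductorNorm hℓ hℓN) hsize
  refine ⟨K, iF, iN, hK, h4, hH, ?_, hcl⟩
  rw [hdK]
  exact h.L_ne_zero_odd hBT hw

/-- **THE DOOR, even base `W = E_{2pr}`** (same statement for `E_{2pr}`, `N(E_{2pr})` supported on `{2, p, r}`).
[cite: BurungaleTian2026, Thm. 1.1] [cite: Oesterle1988Gauss, II §3 Proposition p. 57 (27)] -/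
theorem cruxOnE2pr_of_BT (hBT : burungaleTian_analyticRank_eq_zero_of_selmerCorank_eq_zero_of_hasCM)
    (hw : rcp.wins2PR pc rc rp = true) (h : rcp.RealisesK1 pc rc rp p r q)
    [(congruentNumberCurve (2 * (p * r))).IsElliptic]
    (hsize : Real.sqrt ((∏ i, q i : ℕ) : ℝ) * Real.log ((∏ i, q i : ℕ) : ℝ) < Real.pi * p) :
    ∃ (K : Type) (_ : Field K) (_ : NumberField K),
      IsImaginaryQuadratic K ∧ 4 < (NumberField.discr K).natAbs ∧
      SatisfiesHeegnerHypothesis ((congruentNumberCurve (2 * (p * r))).conductorNorm ℤ) K ∧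
      ((congruentNumberCurve (2 * (p * r))).quadraticTwist (NumberField.discr K : ℚ)).entireLFunction 1 ≠ 0 ∧
      ¬ p ∣ NumberField.classNumber K := by
  have hh : rcp.heegner pc (some rc) = true := by
    simp only [Recipe.wins2PR, Bool.and_eq_true] at hw; exact hw.1
  have hN : ∀ ℓ : ℕ, ℓ.Prime → ℓ ∣ (congruentNumberCurve (2 * (p * r))).conductorNorm ℤ → ℓ ∣ 2 * (p * r) := by
    intro ℓ hℓ hℓN
    have h4 : ℓ ∣ 2 * (2 * (p * r)) := dvd_two_mul_of_prime_dvd_conductorNorm hℓ hℓN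
    rcases (Nat.Prime.dvd_mul hℓ).mp h4 with h2 | h2
    · exact dvd_mul_of_dvd_left h2 _
    · exact h2
  obtain ⟨K, iF, iN, hK, hdK, h4, hH, hcl⟩ := h.exists_heegnerField hh hN hsize
  refine ⟨K, iF, iN, hK, h4, hH, ?_, hcl⟩
  rw [hdK]
  exact h.L_ne_zero_even hBT hw

end Recipe.RealisesK1

/-- ★ **THE CRUX BODY ON THE TWO-PARAMETER FAMILY `W = E_{pr}`, GIVEN A REALISED WINNING RECIPE** (modulo Burungale–Tian ONLY):
for `W = E_{pr}` and the crux's binders, IF some winning recipe of the sign-table game (any base classes) is realised by primes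
`q₁ … q_t` with `√(q₁⋯q_t)·log(q₁⋯q_t) < π p`, THEN the conclusion of `HeegnerTwistCouplingInSupply` holds for `(W, p)`. By
`…SignTableCompletion.lean` a winning recipe EXISTS against every non-character column `(·/p)`; that small primes REALISE it is the
card's analytic input (Burgess / bilinear sieve), NOT supplied here. `HasCM`, `r_an = 1`, `CMInert`, `¬ Good`, the ∀B-supply are idle.
[cite: BurungaleTian2026, Thm. 1.1] [cite: Oesterle1988Gauss, II §3 Proposition p. 57 (27)] -/
theorem heegnerTwistCouplingInSupply_of_signTable_of_BT
    (hBT : burungaleTian_analyticRank_eq_zero_of_selmerCorank_eq_zero_of_hasCM) :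
    ∀ (W : WeierstrassCurve ℚ) [W.IsElliptic] [W.IsGloballyMinimal] (p : ℕ) [Fact p.Prime] [NeZero (W.conductorNorm ℤ)],
      (∃ (r : ℕ) (rcp : Recipe) (pc rc : Fin 4) (rp : Bool) (q : Fin rcp.t → ℕ),
        W = congruentNumberCurve (p * r) ∧ rcp.winsPR pc rc rp = true ∧ rcp.RealisesK1 pc rc rp p r q ∧
        Real.sqrt ((∏ i, q i : ℕ) : ℝ) * Real.log ((∏ i, q i : ℕ) : ℝ) < Real.pi * p) →
      W.HasCM → W.analyticRank = 1 → 5 ≤ p → CMInert W p → ¬ Good W p →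
      (∀ B : ℕ, ∃ (K : Type) (_ : Field K) (_ : NumberField K), IsImaginaryQuadratic K ∧ B < (NumberField.discr K).natAbs ∧
        4 < (NumberField.discr K).natAbs ∧ SatisfiesHeegnerHypothesis (W.conductorNorm ℤ) K ∧ ¬ p ∣ NumberField.classNumber K) →
      ∃ (K : Type) (_ : Field K) (_ : NumberField K),
        IsImaginaryQuadratic K ∧ 4 < (NumberField.discr K).natAbs ∧
        SatisfiesHeegnerHypothesis (W.conductorNorm ℤ) K ∧
        (W.quadraticTwist (NumberField.discr K : ℚ)).entireLFunction 1 ≠ 0 ∧ ¬ p ∣ NumberField.classNumber K := by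
  intro W _ _ p _ _ hW _ _ _ _ _ _
  obtain ⟨r, rcp, pc, rc, rp, q, rfl, hw, h, hsize⟩ := hW
  exact h.cruxOnEpr_of_BT hBT hw hsize

/-- ★ **THE CRUX BODY ON THE TWO-PARAMETER FAMILY `W = E_{2pr}`, GIVEN A REALISED WINNING RECIPE** (modulo Burungale–Tian ONLY).
[cite: BurungaleTian2026, Thm. 1.1] [cite: Oesterle1988Gauss, II §3 Proposition p. 57 (27)] -/
theorem heegnerTwistCouplingInSupply_of_signTable_even_of_BT
    (hBT : burungaleTian_analyticRank_eq_zero_of_selmerCorank_eq_zero_of_hasCM) :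
    ∀ (W : WeierstrassCurve ℚ) [W.IsElliptic] [W.IsGloballyMinimal] (p : ℕ) [Fact p.Prime] [NeZero (W.conductorNorm ℤ)],
      (∃ (r : ℕ) (rcp : Recipe) (pc rc : Fin 4) (rp : Bool) (q : Fin rcp.t → ℕ),
        W = congruentNumberCurve (2 * (p * r)) ∧ rcp.wins2PR pc rc rp = true ∧ rcp.RealisesK1 pc rc rp p r q ∧
        Real.sqrt ((∏ i, q i : ℕ) : ℝ) * Real.log ((∏ i, q i : ℕ) : ℝ) < Real.pi * p) →
      W.HasCM → W.analyticRank = 1 → 5 ≤ p → CMInert W p → ¬ Good W p →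
      (∀ B : ℕ, ∃ (K : Type) (_ : Field K) (_ : NumberField K), IsImaginaryQuadratic K ∧ B < (NumberField.discr K).natAbs ∧
        4 < (NumberField.discr K).natAbs ∧ SatisfiesHeegnerHypothesis (W.conductorNorm ℤ) K ∧ ¬ p ∣ NumberField.classNumber K) →
      ∃ (K : Type) (_ : Field K) (_ : NumberField K),
        IsImaginaryQuadratic K ∧ 4 < (NumberField.discr K).natAbs ∧
        SatisfiesHeegnerHypothesis (W.conductorNorm ℤ) K ∧
        (W.quadraticTwist (NumberField.discr K : ℚ)).entireLFunction 1 ≠ 0 ∧ ¬ p ∣ NumberField.classNumber K := by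
  intro W _ _ p _ _ hW _ _ _ _ _ _
  obtain ⟨r, rcp, pc, rc, rp, q, rfl, hw, h, hsize⟩ := hW
  exact h.cruxOnE2pr_of_BT hBT hw hsize

end Door

end Summit.BirchSwinnertonDyer.BirchSwinnertonDyer.Theorems.SymbolicMonsky
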